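import Literature.MathematicalPhysics.QuantumFieldTheory.Balaban1983to89.B9Cor36GpCoverBindersUnitary
import Literature.MathematicalPhysics.QuantumFieldTheory.Balaban1983to89.B9Cor36CinvCoverBinders
import Literature.MathematicalPhysics.QuantumFieldTheory.Balaban1983to89.B9Thm39CinvAtCoverLargeDefect
import Literature.MathematicalPhysics.QuantumFieldTheory.Balaban1983to89.B9Thm311PosAtRecordV4

/-!
# `Balaban1983to89.B9Thm32CinvAtMemberOfCubeData` — [B9] THEOREMS 3.7 + 3.9 ⇒ THEOREM 3.2 (3.48) p. 398 FOR `C(U) = (Q′G′²Q′*)⁻¹(U)` AT A `U(N)`-VALUED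
# (3.35)-REGULAR BACKGROUND, FOR EVERY MEMBER ABOVE ONE THRESHOLD, FROM THE PER-CUBE (3.35) DATA — MODULO THE LOCALIZED [2]-DIFFERENCE MAJORANT `hD`
# (cell GAPS G-B9-05, «Theorem D», p21 lineage): p21's M5.6 end statement `B9Thm39CinvAtCoverLargeDefect.cinv_cover_large_defect` INSTANTIATED at the matrix
# fibre with every binder but `hD` supplied by name — `hE`∕`hEc` by seat p33's FILE 9, `Cl`∕`E`∕`hdef`∕`hC`∕`hEd` by p21's E2-6, `IsUnit (Q′G′²Q′*)` by dag-n06's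
# Thm 3.11 file, contractive transporters by unitarity — and ONE admissible choice of the rate data (sub-row G-B9-LETTERS, modules M5.1b-G′ × M5.2-E × M5.6,
# FILE 10 of seat p33; the member-level C-junction the M5.9 assembler calls)

T. Bałaban, *Propagators for lattice gauge theories in a background field*, Commun. Math. Phys. **99** (1985) 389–434
[`Balaban1985BackgroundPropagators`, "B9"]; [4] = T. Bałaban, *Propagators and renormalization transformations for lattice gauge
theories. II*, Commun. Math. Phys. **96** (1984) 223–250 [`Balaban1984PropagatorsII`].

statement-level skeleton of published theorems with citation tags; proofs where landed; nothing here is a claim about the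
Yang–Mills mass gap

THE PRINTED LOCUS (verbatim, held `paper:balaban1985-cmp99-background-propagators`, journal page = PDF page + 388).  Thm 3.2 (3.48) p. 398; p. 409 l. 1–5 («the
sequence {Ω_n(□)} satisfies the assumptions of Corollary 3.6 … C_□(U) = (Q′(U)G′²_□(U)Q′*(U))⁻¹ … satisfy all the inequalities of Theorems 3.1–3.3»); p. 411 (3.95)
«… = I − R», «By the same estimates as in [4], especially (2.83)–(2.85), we can see that the operator R is small and (Q′G′²Q′*)⁻¹ = C₀(I − R)⁻¹ = Σ C₀Rⁿ (3.96)»;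
p. 412 («the operators may differ outside □̃₀ … e^{−2δ₀M}» — the [2]-difference, `hD`); p. 413 Thm 3.9 «For M sufficiently large … This theorem implies
Theorem 3.2»; Thm 3.7 pp. 409–410; Cor. 3.6 p. 408 l. 1–10, l. 20–25; (3.24)–(3.25) p. 394, Thm 3.11 p. 416 (positivity of `Δ′_a`, `Q′G′²Q′*`); [4] Lemma 2.1
(2.61)–(2.66) p. 234, (2.83)–(2.87) pp. 237–238.

WHY THIS FILE.  p21's `cinv_cover_large_defect` (M5.6 with the (R)-design defect, cell GAPS G-B9-p21-01) is Theorem 3.9 ⇒ Theorem 3.2 at the cube cover of record for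
every member above one threshold; per member it displays the `EBlock`s of `G′` and of the cube letters `G′_□` (`hE`, `hEc`), `IsUnit (Q′G′²Q′*)`, contractive
transporters `hpar`, the C-letters `Cl`, `E` with `hdef`, `hC`, `hEd`, and the localized [2]-difference majorants `hD`, under NINETEEN rate∕constant parameters with
seventeen side conditions.  Everything but `hD` is now in the tree at print's fibre `𝔸 = M_N(ℂ)`, `U` with values in `G ≤ U(N)`, from ONE family of per-cube (3.35)
data (FILE 9 §3 `exists_cubeData_of_reg335Cubes`): `hE`∕`hEc` = FILE 9 `B9Cor36GpCoverBindersUnitary.eBlock_GpY_of_cubeData_unitary` (Thm 3.7 ⇒ Thm 3.1 for `G′`,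
seat p33); `Cl`∕`E`∕`hdef`∕`hC`∕`hEd` = p21's E2-6 `B9Cor36CinvCoverBinders.cinvLoc_cover_binders` (Cor. 3.6 for the `C_□`); `IsUnit (Q′G′²Q′*)(U)` = dag-n06's
`B9Thm311PosAtRecordV4.isUnit_XY_parSymY` (Thm 3.11); `hpar` = unitarity (`Node00.parSymY_mem` + FILE 9 `bicontractive_of_mem`).  THIS FILE makes the ONE
admissible choice of the rate data from the three existential rates — `δ_G` (FILE 9), `δ_C` (E2-6) and Theorem D's `δ_D` (a PARAMETER here): master rate
`δ₀ := min(δ_G, δ_C, δ_D)`, `α_G = α₂ = α′ = ½`, `a_L = ¼`, `α_st = a_sep = α_c = ρ = a_E = 1⁄16`, `a_D = b = ⅛`, `a_X := a_X′∕δ₀`, constants `B_G := K_G`,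
`B₀ := B₀′`, `κ_E := κ_E′` (§1 checks the seventeen conditions) — and instantiates: ★★★ `cinv_at_member_of_cubeData_unitary` — for Theorem D's constants `κ_D ≥ 0`,
`δ_D > 0` there are `δ > 0`, `K ≥ 0`, thresholds and `a₁ > 0` such that for every member above the thresholds with `c_f = L^k`, every section `ιB`, every `G`-valued
`U`, every family of per-cube (3.35) data and every background family through `U`: IF the localized [2]-difference majorants hold in M5.6's VERBATIM shape at
factor `κ_D·e^{−2δ_D·D_sep}` and every rate `a ≤ δ_D` (the displayed `hD`, a function of the rate — p21 g35's announced output shape of Theorem D), THEN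
`conj b((η²η²)⁻¹•(Q′G′²Q′*)⁻¹(U)) ≺ K·ℓ(a)⁻⁴·e^{−δd(a,a′)}` on the block carrier — THEOREM 3.2 (3.48) for `C(U)`, `δ = δ₀∕32`.

HONEST SCOPE / NOT CLAIMED.  Composition of landed theorems with elementary rate arithmetic; NO estimate of [B9] is proved here.  DISPLAYED: the per-cube (3.35)
data family (p33's `gp_cube_at_locCfg` form, bi-contractive gauges; which class cube supplies `Q_□ ⊇ NearC_□(35S_j∕8 + 1)` is FILE 4's open question (Q1)),
the member thresholds (existential, «For M sufficiently large»), the (3.37) smallness `α₁(□) ≤ min(a₁, 1∕4)`, `c_f = L^k`, the section `ιB`, `N ≥ 1`, a real basis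
`b` of `M_N(ℂ)` with coordinate bound `M₂`, and THE LOCALIZED [2]-DIFFERENCE MAJORANTS `hD` (cell GAPS G-B9-05 — NOT derived in the tree; Theorem D in flight,
p21 lineage) with its constants `κ_D, δ_D` as parameters.  The rate `δ = min(δ_G, δ_C, δ_D)∕32` is ONE admissible choice (print: «a decay rate arbitrarily close» —
not pursued); the constant `K` is M5.6's, explicit but unoptimised.  The C-letters carry the (R)-design defect `E_□` of GAPS G-B9-p21-01 (print's `C_□` needs none;
nothing fails as printed).  Sup-entry (3.48) only; finite 𝕋 members of the k-level V1 family; count-neutral; no summit ∕ sub-problem statement is proved; nothing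
continuum ∕ OS ∕ mass-gap ∕ Clay; NOT a node discharge.  No `sorry`, no `axiom`, no `… : Prop` fact, no `instance`, no `notation`, no `def`.  NEW file; nothing
landed is modified.  Cell `lit-balaban`, seat `lit-balaban-p33` gen 98, 2026-08-28; `--supports stmt-QuantumFields-19200` as helper.  Net new unproved facts: 0.

RELATED IN THE TREE, NOT DUPLICATED (searched 2026-08-28: `lean search 'CinvAtMemberOfCubeData|cinv_at_member' --decl` = ∅): M5.6 E1-4 `B9Thm39CinvAtCoverLargeDefect`
(USED — the engine), M5.5 FILE 7 §3 `B9Thm37GpAtCoverLarge.cinv_large_of_localInverse` (the exact-law edition with M5.5's per-member data displayed; superseded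
inputs, not modified), FILE 9, E2-6, `B9Thm311PosAtRecordV4` (USED).
-/

noncomputable section

open scoped BigOperators Matrix Matrix.Norms.L2Operator

namespace Literature.MathematicalPhysics.QuantumFieldTheory.Balaban1983to89.B9Thm32CinvAtMemberOfCubeData

open B4PartitionUnity22 (thetaProf D1)
open B9Eq39Adjoint (fluct covD)
open B6KLevelCensusIndexV1 (KIdx kGeo)
open B6Cover236MultiLevelBlocks (cubes)
open B6Cover236MultiLevelTorusBlocks (hB cubeIndT)
open B6GlobalChartV1 (PV boxEquiv)
open B6Ineq2142KLevelV1 (β)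
open B6RandomWalk (HasMajorant hasMajorant_mono)
open B9BackgroundsKLevelV1 (shiftsV1)
open B9Eq352DivFormLetters (conj)
open B9Eq360DeltaPrimeAY (AfldY)
open B9CubeGeometryInputs (RM1)
open B9GeoNormsKLevelV1 (geo9K)
open B9GeoLemma21KLevelV1 (one_le_Mh)
open B9Thm34Ext (toB6)
open B9FromB6 (EBlock)
open B9CubeLettersInvReadings (kernelFamilySInv)
open B9Cor36CubeCutoffs (SC NearC chiY locCfgY)
open B9Cor36GpCubeLocLetter (locLetterY)
open B9Cor36CinvCubeLocLetter (cinvLocLetterY cinvLocDefectY)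
open B9Cor36CubeTwinsGeometry (nearN)
open B9Cor36CinvCoverBinders (cinvLoc_cover_binders)
open B9Cor36GpCoverBindersUnitary (eBlock_GpY_of_cubeData_unitary bicontractive_of_mem)
open B9Thm37CubeCoverCommutators (cutMulY)
open B9Thm37CubeCoverCommutatorSizes (four_le_P')
open B9Thm37GpAtCoverLarge (geo9K_M_eq')
open B9Thm39CinvAtCover (chiBigT DsepT DsepT_nonneg)
open B9Thm39CinvAtCoverLargeDefect (cinv_cover_large_defect)
open B9Thm311PosAtRecordV4 (isUnit_XY_parSymY)
open B7Prop2Explicit (unitaryUnits)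
open Node00 (SiteY BlkY CfgY GaugeY IBondY toKT gaugeY parSymY parSymY_mem XY XinvY GpY etaS)

variable {d ℓ : ℕ} {hd : 1 ≤ d + 1} {hL : Odd (ℓ + 1) ∧ 1 < ℓ + 1} {b₀ b₁ : ℝ}

/-! ## §1 One admissible choice of M5.6's rate data from three positive rates -/

/-- **THE SEVENTEEN SIDE CONDITIONS OF `cinv_cover_large_defect` AT THE CHOICE `δ₀ := m ≤ min(δ_G, δ_C, δ_D)`, `α_G = α₂ = α′ = ½`, `a_L = ¼`,
`α_st = a_sep = α_c = ρ = a_E = 1⁄16`, `a_D = b = ⅛`** (those that are not closed numeral facts): `α_Gδ_G > 0`, `(1−α_G)δ_G > 0`, `a_Lδ₀ ≤ (1−α₂)(1−α_G)δ_G`, `α_cδ₀ > 0`,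
and the consumers' rate windows `bδ₀, a_Eδ₀ ≤ δ_C`, `a_Dδ₀ ≤ δ_D`. [cite: Balaban1985BackgroundPropagators, Thm 3.9 p.413 («For M sufficiently large»), p.410 («a decay rate arbitrarily close»), bookkeeping] -/
theorem rate_choice {δG δC δD m : ℝ} (hδG : 0 < δG) (hm0 : 0 < m) (hmG : m ≤ δG) (hmC : m ≤ δC) (hmD : m ≤ δD) :
    0 < 1 / 2 * δG ∧ 0 < (1 - 1 / 2) * δG ∧ 1 / 4 * m ≤ (1 - 1 / 2) * ((1 - 1 / 2) * δG) ∧ 0 < 1 / 16 * m ∧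
      0 ≤ 1 / 8 * m ∧ 1 / 8 * m ≤ δC ∧ 0 ≤ 1 / 16 * m ∧ 1 / 16 * m ≤ δC ∧ 1 / 8 * m ≤ δD ∧ 0 < (1 - 1 / 2) * (1 / 16 * m) := by
  refine ⟨by linarith, by linarith, by linarith, by linarith, by linarith, by linarith, by linarith, by linarith, by linarith, by linarith⟩

/-- weakening Theorem D's separation factor `e^{−2δ_D·D_sep} ≤ e^{−2δ₀·D_sep}` for `δ₀ ≤ δ_D` inside the `hD` kernel (all other factors nonnegative).
[cite: Balaban1985BackgroundPropagators, p.412 («estimated by … e^{−2δ₀M}»), bookkeeping] -/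
theorem hD_kernel_mono {κD δD m D w t a : ℝ} (hκD : 0 ≤ κD) (hmD : m ≤ δD) (hD : 0 ≤ D) (hw : 0 ≤ w) :
    κD * Real.exp (-(2 * δD * D)) * w * Real.exp (-(a * t)) ≤ κD * Real.exp (-(2 * m * D)) * w * Real.exp (-(a * t)) := by
  have h : Real.exp (-(2 * δD * D)) ≤ Real.exp (-(2 * m * D)) := Real.exp_le_exp.2 (by nlinarith)
  exact mul_le_mul_of_nonneg_right (mul_le_mul_of_nonneg_right (mul_le_mul_of_nonneg_left h hκD) hw) (Real.exp_nonneg _)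

/-! ## §2 ★★★ Theorem 3.2 (3.48) for `C(U)` at a `U(N)`-valued (3.35)-regular background, from the cube data, modulo Theorem D -/

section Main

variable {N : ℕ} {G : Subgroup (Matrix (Fin N) (Fin N) ℂ)ˣ}
variable {ι : Type} [Fintype ι] [DecidableEq ι] (b : Module.Basis ι ℝ (Matrix (Fin N) (Fin N) ℂ))

/-- ★★★ **THEOREMS 3.7 + 3.9 ⇒ THEOREM 3.2 (3.48) FOR `C(U) = (Q′G′²Q′*)⁻¹(U)` AT A `U(N)`-VALUED (3.35)-REGULAR BACKGROUND, FOR EVERY MEMBER ABOVE ONE THRESHOLD, FROM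
THE PER-CUBE (3.35) DATA, MODULO THEOREM D** (p21's `cinv_cover_large_defect` with `hE`∕`hEc` ← FILE 9, `Cl`∕`E`∕`hdef`∕`hC`∕`hEd` ← E2-6, `IsUnit (Q′G′²Q′*)` ← Thm 3.11,
`hpar` ← unitarity, rates chosen in §1): for `G ≤ U(N)`, `N ≥ 1`, the walk data `(Rr, Hp)`, a real basis `b` of `M_N(ℂ)` with coordinate bound `M₂` and Theorem D's
constants `κ_D ≥ 0`, `δ_D > 0`, there are `δ > 0`, `K ≥ 0`, thresholds `M₀, T₀, N₀` and `a₁ > 0` such that for every member above the thresholds with `c_f = L^k`,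
every section `ιB`, every `G`-valued `U`, every family of per-cube (3.35) data — bi-contractive gauges `u_□`, potentials `A_□` on torus sets `Q_□ ⊇ NearC_□(35S_j∕8 + 1)`
with `U^{u_□} = e^{iηA_□}` on their bonds, `‖A_□‖ ≦ C_□ξ_□⁻¹`, `‖η⁻¹∂A_□‖ ≦ C_□ξ_□⁻²`, `0 < ξ_□ ≦ 5S_jη`, `L^{j+1}η ≦ Λ_□ξ_□`, `1 ≦ Λ_□`,
`max C_□ (C_□(1+D₁θ))Λ_□² ≦ min(a₁, 1∕4)` — and every background family through `U`: IF for every rate `0 ≤ a ≤ δ_D` and every cube the localized [2]-difference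
`χ̃_□·[Q′G′²Q′*(G′(U)) − Q′G′²Q′*(O_□)]·1_{□⁺}` (in `conj b` currency, scaled by `(η²)²`) has the majorant `κ_D·e^{−2δ_D·D_sep}·ℓ(a)⁴·e^{−a·d(a,a″)}` on the block
carrier (cell GAPS G-B9-05, displayed), THEN `conj b((η²η²)⁻¹•(Q′G′²Q′*)⁻¹(U; parSymY)) ≺ K·ℓ(a)⁻⁴·e^{−δ·d(a,a′)}`.
[cite: Balaban1985BackgroundPropagators, Thm 3.9 p.413 + (3.95)–(3.97) pp.411–412 + p.409 l.1–5 + Thm 3.7 pp.409–410 + Cor. 3.6 p.408 + Thm 3.2 (3.48) p.398 + Thm 3.11 p.416; Balaban1984PropagatorsII, (2.83)–(2.87) pp.237–238 + Lemma 2.1 (2.61)–(2.66) p.234] -/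
theorem cinv_at_member_of_cubeData_unitary [Nonempty (Fin N)] [∀ i' : KIdx d ℓ hd hL b₀ b₁, Fintype (geo9K i').Site]
    [∀ i' : KIdx d ℓ hd hL b₀ b₁, DecidableEq (geo9K i').Site] (hG : G ≤ unitaryUnits (Matrix (Fin N) (Fin N) ℂ))
    (Rr : KIdx d ℓ hd hL b₀ b₁ → ℝ) (Hp : KIdx d ℓ hd hL b₀ b₁ → Prop)
    (hℓ : 1 ≤ ℓ) {M₂ : ℝ} (hM₂ : 0 ≤ M₂) (hrepr : ∀ (v : Matrix (Fin N) (Fin N) ℂ) (j : ι), |b.repr v j| ≤ M₂ * ‖v‖)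
    {κD δD : ℝ} (hκD : 0 ≤ κD) (hδD : 0 < δD) :
    ∃ δ K M₀ T₀ : ℝ, ∃ N₀ : ℕ, 0 < δ ∧ 0 ≤ K ∧ ∃ a₁ : ℝ, 0 < a₁ ∧
    ∀ (i : KIdx d ℓ hd hL b₀ b₁),
      M₀ ≤ ((ℓ : ℝ) + 1) * (toKT i).Mh → N₀ + 1 ≤ (toKT i).R * ((ℓ + 1) * (toKT i).Mh) → T₀ ≤ RM1 i → i.cf = (((ℓ + 1 : ℕ) : ℝ)) ^ i.k →
    ∀ (ιB : BlkY i → IBondY i), (∀ s, β i.hN i.D i.hk (ιB s) = s) →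
    ∀ (U : CfgY (Matrix (Fin N) (Fin N) ℂ) i), (∀ μ x, U μ x ∈ G) →
    ∀ (g : ↥(cubes (toKT i).D.toDomains) → GaugeY (Matrix (Fin N) (Fin N) ℂ) i),
      (∀ c x, ‖(g c x : Matrix (Fin N) (Fin N) ℂ)‖ ≤ 1 ∧ ‖(((g c x)⁻¹ : (Matrix (Fin N) (Fin N) ℂ)ˣ) : Matrix (Fin N) (Fin N) ℂ)‖ ≤ 1) →
    ∀ (A : ↥(cubes (toKT i).D.toDomains) → AfldY (Matrix (Fin N) (Fin N) ℂ) i)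
      (Q : ↥(cubes (toKT i).D.toDomains) → Set (Site (PV d ℓ i.m i.K hd hL) 0)) (C ξ Λ : ↥(cubes (toKT i).D.toDomains) → ℝ),
      (∀ c, 0 ≤ C c) → (∀ c, 0 < ξ c) → (∀ c, 1 ≤ Λ c) → (∀ c, ξ c ≤ 5 * (SC i c : ℝ) * (kGeo i).eta) →
      (∀ c, LatticeNorms.scaleLen ((ℓ : ℝ) + 1) (kGeo i).eta (c.1.1 + 1) ≤ Λ c * ξ c) →
      (∀ c, ∀ x : Site (PV d ℓ i.m i.K hd hL) 0, NearC i c (35 * SC i c / 8 + 1) (boxEquiv i.hN x).1 → x ∈ Q c) →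
      (∀ c, ∀ (κ : Fin (d + 1)) (x : Site (PV d ℓ i.m i.K hd hL) 0), x ∈ Q c → x.shift κ ∈ Q c →
        gaugeY i (g c) U κ x = fluct (kGeo i).eta (A c) κ x) →
      (∀ c, ∀ κ, ∀ x ∈ Q c, ‖A c κ x‖ ≤ C c * (ξ c)⁻¹) →
      (∀ c, ∀ μ ν, ∀ x ∈ Q c,
        ‖(((kGeo i).eta : ℂ)⁻¹) • covD (shiftsV1 (PV d ℓ i.m i.K hd hL)) (fun _ _ => (1 : (Matrix (Fin N) (Fin N) ℂ)ˣ)) μ (A c ν) x‖ ≤ C c * (ξ c ^ 2)⁻¹) →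
      (∀ c, max (C c) (C c * (1 + D1 thetaProf)) * Λ c ^ 2 ≤ a₁) → (∀ c, max (C c) (C c * (1 + D1 thetaProf)) * Λ c ^ 2 ≤ 1 / 4) →
    ∀ {B : B9.Backgrounds} (cfg : B.Cfg → CfgY (Matrix (Fin N) (Fin N) ℂ) i) (U₁ : B.Cfg), cfg U₁ = U →
      (∀ a : ℝ, 0 ≤ a → a ≤ δD → ∀ c : ↥(cubes (toKT i).D.toDomains),
        HasMajorant (g := toB6 (geo9K i) (Rr i) (Hp i)) (fun p : BlkY i × ι => ιB p.1)
          (conj b ((etaS i ^ 2 * etaS i ^ 2) • ((cutMulY (𝔸 := Matrix (Fin N) (Fin N) ℂ) (chiBigT i c)).restrictScalars ℝ *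
            ((XY i (parSymY i) (GpY i (parSymY i)) U).restrictScalars ℝ -
              (XY i (parSymY i) (fun _ => locLetterY i c (parSymY i) (g c) (chiY i c) (locCfgY i c (kGeo i).eta (A c))) U).restrictScalars ℝ) *
            (cutMulY (𝔸 := Matrix (Fin N) (Fin N) ℂ) (cubeIndT i.D (one_le_Mh i) (four_le_P' i) c)).restrictScalars ℝ)))
          (fun a₀ a'' => κD * Real.exp (-(2 * δD * DsepT i)) * (geo9K i).len a₀ ^ 4 * Real.exp (-(a * (geo9K i).dist a₀ a'')))) →
      HasMajorant (g := toB6 (geo9K i) (Rr i) (Hp i)) (fun p : BlkY i × ι => ιB p.1)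
        (conj b ((etaS i ^ 2 * etaS i ^ 2)⁻¹ • (XinvY i (parSymY i) (GpY i (parSymY i)) U).restrictScalars ℝ))
        (fun a a' => K * ((geo9K i).len a ^ 4)⁻¹ * Real.exp (-(δ * (geo9K i).dist a a'))) := by
  -- the G′ side (FILE 9): `(δ_G, K_G)`, thresholds, `a₁`
  obtain ⟨δG, KG, M₀, T₀, N₀, hδG, hKG, a₁, ha₁, HG⟩ := eBlock_GpY_of_cubeData_unitary b hG Rr Hp hℓ hM₂ hrepr
  -- the C side (E2-6): thresholds, `a₁′`, `(δ_C, a_X′, B₀′, κ_E′)`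
  obtain ⟨M₀', T₀', N₀', a₁', ha₁', δC, aX', B₀', κE', hδC, haX', hB₀', hκE', HC⟩ :=
    cinvLoc_cover_binders b (hd := hd) (hL := hL) (b₀ := b₀) (b₁ := b₁) hℓ hM₂ hrepr
  -- the master rate `m = min(δ_G, δ_C, δ_D)` and the rate choice of §1
  obtain ⟨m, hm⟩ : ∃ m : ℝ, m = min δG (min δC δD) := ⟨_, rfl⟩
  have hm0 : 0 < m := by rw [hm]; exact lt_min hδG (lt_min hδC hδD)
  have hmG : m ≤ δG := by rw [hm]; exact min_le_left _ _
  have hmC : m ≤ δC := by rw [hm]; exact (min_le_right _ _).trans (min_le_left _ _)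
  have hmD : m ≤ δD := by rw [hm]; exact (min_le_right _ _).trans (min_le_right _ _)
  obtain ⟨hαGδ, hδG2, hrate, hαc, h8₀, h8C, h16₀, h16C, h8D, hδpos⟩ := rate_choice hδG hm0 hmG hmC hmD
  have haX : 0 < aX' / m := div_pos haX' hm0
  -- M5.6's end statement at this rate data
  obtain ⟨ML, K, hK, HM⟩ := cinv_cover_large_defect (𝔸 := Matrix (Fin N) (Fin N) ℂ) Rr Hp b hM₂ hrepr
    (δG := δG) (αG := 1 / 2) (α₂ := 1 / 2) (δ₀ := m) (αst := 1 / 16) (bb := 1 / 8) (ρ := 1 / 16) (α' := 1 / 2) (aL := 1 / 4) (aD := 1 / 8)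
    (aE := 1 / 16) (aX := aX' / m) (αc := 1 / 16) (asep := 1 / 16) (BG := KG) (B₀ := B₀') (κD := κD) (κE := κE')
    hαGδ (by norm_num) (by norm_num) hδG2 hm0 (by norm_num) (by norm_num) (by norm_num) (by norm_num) (by norm_num) hrate (by norm_num) hαc
    (by norm_num) (by norm_num) (by norm_num) le_rfl haX hKG hB₀' hκD hκE'
  refine ⟨(1 - 1 / 2) * (1 / 16 * m), K, max (max M₀ M₀') ML, max T₀ T₀', max N₀ N₀', hδpos, hK, min a₁ a₁', lt_min ha₁ ha₁', ?_⟩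
  intro i hM hN hT hcf ιB hι U hU g hu A Q C ξ Λ hC0 hξ hΛ hξS hΛξ hQ hgA hA hdA hα₁ hα4 B cfg U₁ hcfg hDf
  -- the thresholds of the three suppliers
  have hM₀ : M₀ ≤ ((ℓ : ℝ) + 1) * (toKT i).Mh := ((le_max_left _ _).trans (le_max_left _ _)).trans hM
  have hM₀' : M₀' ≤ ((ℓ : ℝ) + 1) * (toKT i).Mh := ((le_max_right _ _).trans (le_max_left _ _)).trans hM
  have hML : ML ≤ (geo9K i).M := by
    rw [geo9K_M_eq' i]; exact (le_max_right _ _).trans hM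
  have hN₀ : N₀ + 1 ≤ (toKT i).R * ((ℓ + 1) * (toKT i).Mh) := (Nat.add_le_add_right (le_max_left _ _) 1).trans hN
  have hN₀' : N₀' + 1 ≤ (toKT i).R * ((ℓ + 1) * (toKT i).Mh) := (Nat.add_le_add_right (le_max_right _ _) 1).trans hN
  have hT₀ : T₀ ≤ RM1 i := (le_max_left _ _).trans hT
  have hT₀' : T₀' ≤ RM1 i := (le_max_right _ _).trans hT
  have hα₁G : ∀ c, max (C c) (C c * (1 + D1 thetaProf)) * Λ c ^ 2 ≤ a₁ := fun c => (hα₁ c).trans (min_le_left _ _)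
  have hα₁C : ∀ c, max (C c) (C c * (1 + D1 thetaProf)) * Λ c ^ 2 ≤ a₁' := fun c => (hα₁ c).trans (min_le_right _ _)
  -- the G′ side: `hE`, `hEc` at `(K_G, δ_G)`
  obtain ⟨hE, hEc⟩ := HG i hM₀ hN₀ hT₀ hcf ιB hι U hU g hu A Q C ξ Λ hC0 hξ hΛ hξS hΛξ hQ hgA hA hdA hα₁G hα4 cfg U₁ hcfg
  -- the C side: `hdef`, `hC` at rate `m/8`, `hEd` at rate `m/16`
  obtain ⟨hdef, hC, hEd⟩ := HC i (Rr i) (Hp i) hM₀' hN₀' hT₀' hcf ιB hι U g hu A Q C ξ Λ hC0 hξ hΛ hξS hΛξ hQ hgA hA hdA hα₁C hα4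
    (1 / 8 * m) (1 / 16 * m) h8₀ h8C h16₀ h16C
  -- Theorem D's majorants at rate `m/8`, separation factor weakened to `e^{−2m·D_sep}`
  have hD := fun c : ↥(cubes (toKT i).D.toDomains) =>
    hasMajorant_mono (g := toB6 (geo9K i) (Rr i) (Hp i)) _ (hDf (1 / 8 * m) h8₀ h8D c) fun a₀ a'' =>
      hD_kernel_mono (t := (geo9K i).dist a₀ a'') (a := 1 / 8 * m) hκD hmD (DsepT_nonneg i) (pow_nonneg (B6KLevelCensusIndexV1.len_pos i a₀).le 4)
  -- the defect majorants in M5.6's letters (`a_X·δ₀ = a_X′`)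
  have e : aX' / m * m = aX' := div_mul_cancel₀ aX' hm0.ne'
  have hEd' : ∀ c : ↥(cubes (toKT i).D.toDomains),
      HasMajorant (g := toB6 (geo9K i) (Rr i) (Hp i)) (fun p : BlkY i × ι => ιB p.1)
        (conj b ((cinvLocDefectY i c (parSymY i) (g c) (chiY i c) (locCfgY i c (kGeo i).eta (A c)) (nearN i c) (hB i.D c)).restrictScalars ℝ))
        (fun a a' => κE' * Real.exp (-(aX' / m * m * DsepT i)) * Real.exp (-(1 / 16 * m * (geo9K i).dist a a'))) := by
    rw [e]; exact hEd
  subst hcfg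
  -- Thm 3.11: `Q′G′²Q′*` is a unit; unitarity: contractive transporters
  have hunit : IsUnit (XY i (parSymY i) (GpY i (parSymY i)) (cfg U₁)) := isUnit_XY_parSymY i hG hU
  have hpar : ∀ z w : SiteY i, ‖(parSymY i (cfg U₁) z w : Matrix (Fin N) (Fin N) ℂ)‖ ≤ 1 ∧
      ‖(((parSymY i (cfg U₁) z w)⁻¹ : (Matrix (Fin N) (Fin N) ℂ)ˣ) : Matrix (Fin N) (Fin N) ℂ)‖ ≤ 1 :=
    fun z w => bicontractive_of_mem hG (parSymY_mem i hU z w)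
  exact HM i hML cfg (GpY i (parSymY i)) (parSymY i) ιB
    (fun c _ => locLetterY i c (parSymY i) (g c) (chiY i c) (locCfgY i c (kGeo i).eta (A c))) hE hEc hι hunit hpar
    (fun c => (cinvLocLetterY i c (parSymY i) (g c) (locCfgY i c (kGeo i).eta (A c)) (nearN i c)).restrictScalars ℝ)
    (fun c => (cinvLocDefectY i c (parSymY i) (g c) (chiY i c) (locCfgY i c (kGeo i).eta (A c)) (nearN i c) (hB i.D c)).restrictScalars ℝ)
    hdef hC hD hEd'

end Main

end Literature.MathematicalPhysics.QuantumFieldTheory.Balaban1983to89.B9Thm32CinvAtMemberOfCubeData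

end
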